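import Summits.KontsevichZagierPeriods.KontsevichZagierPeriods.Theses.IsogenyCertificates
import Summits.KontsevichZagierPeriods.KontsevichZagierPeriods.Theorems.IsogenyCertificatesXMapKernelCellsUnconditional
import Summits.KontsevichZagierPeriods.KontsevichZagierPeriods.Theorems.IsogenyCertificatesXMapKernelIffSummit
import Summits.KontsevichZagierPeriods.KontsevichZagierPeriods.Theorems.HurwitzMicroSectorsNormalFormPrincipleDimOneAssembly
import Summits.KontsevichZagierPeriods.KontsevichZagierPeriods.Theorems.HodgeLevelDimOneRationalValues
import Literature.NumberTheory.Transcendental.KZKernelConjectureForms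
import Literature.NumberTheory.Transcendental.ManyCurveStdReduction
import Literature.NumberTheory.Transcendental.ManyCurveSemistabilityTheoremProofs

/-!
# Skeleton — G4 ladder-down rung `LogPeriodCell` under the crux `XMapKernel` (stmt-KontsevichZagierPeriods-10663)

Line `log-period-cell` (planner, unit `fwd-ladder-KontsevichZagierPeriods-50`, 2026-08-17). The crux
`XMapKernel` is certified summit-equivalent (`XMapKernelIffSummit.xMapKernel_iff_summit`), so the CONTENT of this
skeleton is the RUNG `LogPeriodCell` (`LogPeriodCell_of`; kernel conjecture on the mixed genus-0 ⊕ genus-1 sector;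
the ladder is closed to the crux by the flagged limit step `stub_limitStep`), one antitone step above the PROVED real-period cell `XMapKernelCells.realPeriodCellKernel_relations` on the ladder
`MixedCell T := ∀ c ∈ closure (realPeriodGens ∪ T), eval c = 0 → c ∈ relations` (`T = ∅` floor, PROVED;
`T = ratGensLE 1` this rung; `T = Set.univ` ↔ `KontsevichZagierPeriods`). On-path: `XMapKernel → LogPeriodCell`
and `KontsevichZagierPeriods → LogPeriodCell` are proved below.

## The line

Split `c = c_P + c_R` (`AddSubgroup.closure_union`, `mem_sup`) with `c_P ∈ closure realPeriodGens`,
`c_R ∈ closure (ratGensLE 1)`. Value normal forms: `eval c_P = Σ qᵢ·Ω(Aᵢ,Bᵢ)` over pairwise non-x-isogenous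
nonsingular integral cubics (`stub_periodSectorValues`; the merge uses the landed `OrbitCollapse.stub_orbitCollapse`),
`eval c_R = β₀ + Σ βⱼ·yⱼ` with `β` algebraic and `exp yⱼ` algebraic (`stub_ratSectorValues`; generatorwise this is the
PROVED `HodgeLevel.DimOneRationalValues`, stmt-4992). The SEAM `stub_logClassReduction` is the log-enriched form of the
floor's `ClassReduction.stub_classReduction`: the relation `Σ qᵢΩᵢ = β₀ + Σ βⱼyⱼ` already forces the per-ℚ̄-isogeny-class
sums `Σ_{j ∈ class} qⱼΩⱼ` to vanish (Baker–Wüstholz analytic subgroup theorem on the family standard model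
`𝔾ₐ × 𝔾ₘ^m × ∏ E_class`: in the tree as `GaGmEFam.Std.Model.periods_alternatives_of_hyperplaneTheorem` (general `β`) fed by
`GaGmEFam.Std.hyperplaneTheorem_presTors_of_std_torsHyperplane`, `std_torsHyperplane_of_std_tors` and the PROVED
`semistabilityTheorem_famStd_holds`; the model is `HuberWustholzManyCurvePeriods_of_std_torsHyperplane`, `β = Fin 1`).
From the per-class vanishing, the composition below re-runs the floor's HW-free class analysis VERBATIM (landed
`CMClass.stub_cmClass`, `NonCMClass.stub_nonCMClass`, `MultiplierRigidity.stub_multiplierRigidity`,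
`RadicalIndependence.stub_radicalIndependence`, `DatumOfRatMult.stub_datumOfRatMult`) to get `q = 0`; then
`eval c_P = 0 = eval c_R`, and the two PROVED kernel cells (`realPeriodCellKernel_relations`;
`PiBox.Dlog.mem_relations_of_eval_eq_zero_of_dim_le_one`, the kernel form of stmt-10622) finish.

Stubs: 3 rung stubs (`stub_logClassReduction` L — hardest; `stub_periodSectorValues` M; `stub_ratSectorValues` S) +
the flagged LIMIT STEP `stub_limitStep` (summit-strength given the rung; registered only so that `XMapKernel_of`
concludes the crux by name, G4 brief (3)). `sorry` occurs ONLY inside the four `stub_*`; `LogPeriodCell_of` and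
`XMapKernel_of` are real proofs.
-/

namespace Summit.KontsevichZagierPeriods.KontsevichZagierPeriods.Cruxes.XMapKernel.LogPeriodCell

open scoped BigOperators
open Literature.NumberTheory.Transcendental
open Summit.KontsevichZagierPeriods.KontsevichZagierPeriods.Theses.IsogenyCertificates
open Summit.KontsevichZagierPeriods.IsogenyCertificates
open Summit.KontsevichZagierPeriods.IsogenyCertificates.XMapKernelStubs

/-! ## The rung (definitions identical to `Sketch.lean`) -/

/-- Generators of the real-period sector (cell (i)), verbatim the set of `XMapKernelCells.realPeriodCellKernel_relations`. -/
def realPeriodGens : Set KZ.FormalRep :=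
  {d : KZ.FormalRep | ∃ (A B : ℤ) (a : ℚ) (r : KZ.IntegralRep 1), 4 * A ^ 3 + 27 * B ^ 2 ≠ 0 ∧
    r.domain = {x | 0 < x 0 ^ 3 + (A : ℝ) * x 0 + (B : ℝ)} ∧
    Set.EqOn r.integrand (fun x => (a : ℝ) / Real.sqrt (x 0 ^ 3 + (A : ℝ) * x 0 + (B : ℝ))) r.domain ∧
    d = KZ.of r}

/-- Classes of KZ-rational integral representations of dimension `≤ d`. -/
def ratGensLE (d : ℕ) : Set KZ.FormalRep :=
  {c : KZ.FormalRep | ∃ (n : ℕ) (r : KZ.IntegralRep n), n ≤ d ∧ r.IsRational ∧ c = KZ.of r}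

/-- The ladder family. -/
def MixedCell (T : Set KZ.FormalRep) : Prop :=
  ∀ c ∈ AddSubgroup.closure (realPeriodGens ∪ T), KZ.eval c = 0 → c ∈ KZ.relations

/-- **The rung** `LogPeriodCell := MixedCell (ratGensLE 1)`. -/
def LogPeriodCell : Prop := MixedCell (ratGensLE 1)

/-- Floor (`T = ∅`), PROVED: the real-period cell. -/
theorem rung_floor : MixedCell ∅ := by
  intro c hc hc0
  simp only [Set.union_empty] at hc
  exact XMapKernelCells.realPeriodCellKernel_relations c hc hc0

/-- On-path (crux form): `XMapKernel → LogPeriodCell`. -/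
theorem logPeriodCell_of_xMapKernel (h : XMapKernel) : LogPeriodCell :=
  fun c _ hc0 => (XMapKernelIffSummit.xMapKernel_iff_kzKernelConjecture.mp h) c hc0

/-- On-path (summit form): `KontsevichZagierPeriods → LogPeriodCell`. -/
theorem logPeriodCell_of_summit (h : KontsevichZagierPeriods) : LogPeriodCell :=
  logPeriodCell_of_xMapKernel (XMapKernelIffSummit.xMapKernel_iff_summit.mpr h)

/-! ## Stub statements (named, so that `LogPeriodCell_of` reads `S₁ → S₂ → S₃ → LogPeriodCell`) -/

/-- Statement of `stub_logClassReduction` (the SEAM; log-enriched `ClassReduction.stub_classReduction`). -/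
def LogClassReduction : Prop :=
  ∀ (k : ℕ) (A B : Fin k → ℤ) (q : Fin k → ℚ), (∀ i, 4 * A i ^ 3 + 27 * B i ^ 2 ≠ 0) →
    ∀ (m : ℕ) (β₀ : ℂ) (β y : Fin m → ℂ), IsAlgebraic ℚ β₀ → (∀ j, IsAlgebraic ℚ (β j)) →
      (∀ j, IsAlgebraic ℚ (Complex.exp (y j))) →
      ((∑ i, (q i : ℝ) * (∫ x in {x : Fin 1 → ℝ | 0 < x 0 ^ 3 + (A i : ℝ) * x 0 + (B i : ℝ)},
          1 / Real.sqrt (x 0 ^ 3 + (A i : ℝ) * x 0 + (B i : ℝ))) : ℝ) : ℂ) = β₀ + ∑ j, β j * y j →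
      ∀ i, ∃ L₀ : PeriodPair, L₀.g₂ = -4 * (A i : ℂ) ∧ L₀.g₃ = -4 * (B i : ℂ) ∧
        ∀ S : Finset (Fin k), (∀ j, j ∈ S ↔ ∃ (L' : PeriodPair) (α : ℂ), L'.g₂ = -4 * (A j : ℂ) ∧
          L'.g₃ = -4 * (B j : ℂ) ∧ α ≠ 0 ∧ ∀ l ∈ L₀.lattice, α * l ∈ L'.lattice) →
          ∑ j ∈ S, (q j : ℝ) * (∫ x in {x : Fin 1 → ℝ | 0 < x 0 ^ 3 + (A j : ℝ) * x 0 + (B j : ℝ)},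
            1 / Real.sqrt (x 0 ^ 3 + (A j : ℝ) * x 0 + (B j : ℝ))) = 0

/-- Statement of `stub_periodSectorValues` (value normal form on the real-period sector). -/
def PeriodSectorValues : Prop :=
  ∀ c ∈ AddSubgroup.closure {d : KZ.FormalRep | ∃ (A B : ℤ) (a : ℚ) (r : KZ.IntegralRep 1), 4 * A ^ 3 + 27 * B ^ 2 ≠ 0 ∧
      r.domain = {x | 0 < x 0 ^ 3 + (A : ℝ) * x 0 + (B : ℝ)} ∧
      Set.EqOn r.integrand (fun x => (a : ℝ) / Real.sqrt (x 0 ^ 3 + (A : ℝ) * x 0 + (B : ℝ))) r.domain ∧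
      d = KZ.of r},
    ∃ (k : ℕ) (A B : Fin k → ℤ) (q : Fin k → ℚ), (∀ i, 4 * A i ^ 3 + 27 * B i ^ 2 ≠ 0) ∧
      (∀ i j, i ≠ j → ¬ ∃ (f g : Polynomial ℚ) (c : ℚ), Polynomial.derivative f * g - f * Polynomial.derivative g ≠ 0 ∧
        Polynomial.C (c ^ 2) * g * (f ^ 3 + Polynomial.C (A j : ℚ) * f * g ^ 2 + Polynomial.C (B j : ℚ) * g ^ 3) =
          (Polynomial.X ^ 3 + Polynomial.C (A i : ℚ) * Polynomial.X + Polynomial.C (B i : ℚ)) *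
            (Polynomial.derivative f * g - f * Polynomial.derivative g) ^ 2) ∧
      KZ.eval c = ∑ i, (q i : ℝ) * (∫ x in {x : Fin 1 → ℝ | 0 < x 0 ^ 3 + (A i : ℝ) * x 0 + (B i : ℝ)},
        1 / Real.sqrt (x 0 ^ 3 + (A i : ℝ) * x 0 + (B i : ℝ)))

/-- Statement of `stub_ratSectorValues` (value normal form on the KZ-rational sector of dimension `≤ 1`). -/
def RatSectorValues : Prop :=
  ∀ c ∈ AddSubgroup.closure {c : KZ.FormalRep | ∃ (n : ℕ) (r : KZ.IntegralRep n), n ≤ 1 ∧ r.IsRational ∧ c = KZ.of r},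
    ∃ (m : ℕ) (β₀ : ℂ) (β y : Fin m → ℂ), IsAlgebraic ℚ β₀ ∧ (∀ j, IsAlgebraic ℚ (β j)) ∧
      (∀ j, IsAlgebraic ℚ (Complex.exp (y j))) ∧ ((KZ.eval c : ℝ) : ℂ) = β₀ + ∑ j, β j * y j

/-! ## Registered stubs -/

/-- **Stub 1 (L, hardest — the seam): log-enriched class reduction.** For nonsingular integral cubics
`y² = x³ + Aᵢx + Bᵢ` and rationals `qᵢ`, a relation `Σ qᵢ·Ω(Aᵢ,Bᵢ) = β₀ + Σ βⱼ·yⱼ` with `β₀, βⱼ` algebraic and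
`exp yⱼ` algebraic forces every ℚ̄-isogeny-class sub-sum `Σ_{j ∈ class(i)} qⱼ·Ω(Aⱼ,Bⱼ)` to vanish. Case `m = 0`,
`β₀ = 0`: exactly `ClassReduction.stub_classReduction HuberWustholzManyCurvePeriods_holds` (landed). Plan: ℚ-basis
reduction of the `yⱼ`; the class lattices `L : J → PeriodPair` (pairwise non-isogenous, algebraic invariants) and the
isogeny scalings `Ωⱼ = αⱼ(uⱼω₁ + vⱼω₂)` as in the landed proof of `stub_classReduction`; then
`GaGmEFam.Std.Model.periods_alternatives_of_hyperplaneTheorem` with `β := Fin m'`, `x := 1`, blocks `(1,0),(0,1)` per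
non-CM class and one block per CM class, its hypothesis from `hyperplaneTheorem_presTors_of_std_torsHyperplane ∘
std_torsHyperplane_of_std_tors ∘ semistabilityTheorem_famStd_holds`; all three alternatives are contradictory, so the
ℚ̄-coefficients per class vanish. [cite: HuberWustholz2022, Thm. 15.3; BakerWustholz2007, Thm. 6.15] -/
theorem stub_logClassReduction : LogClassReduction := by
  sorry

/-- **Stub 2 (M): value normal form on the real-period sector.** Every element of `closure realPeriodGens`
evaluates to `Σ qᵢ·Ω(Aᵢ,Bᵢ)` over a finite family of PAIRWISE NON-x-ISOGENOUS nonsingular integral cubics (the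
hypothesis shape of `XMapKernelCells.realPeriodIndependence_holds`). Plan: `AddSubgroup.closure_induction`;
a generator `[r]` has value `a·Ω(A,B)` (`setIntegral_congr` on `r.domain`); concatenate families and collapse
x-related (in particular equal) pairs with the landed `OrbitCollapse.stub_orbitCollapse`
(`Ω(A,B) = q·Ω(A',B')`, `q ∈ ℚ_{>0}`), by induction on the family size. [cite: KontsevichZagier2001, §1.2] -/
theorem stub_periodSectorValues : PeriodSectorValues := by
  sorry

/-- **Stub 3 (S): value normal form on the KZ-rational sector of dimension `≤ 1`.** Every element of
`closure (ratGensLE 1)` evaluates (in `ℂ`) to `β₀ + Σ βⱼ·yⱼ` with `β₀, βⱼ` algebraic and `exp yⱼ` algebraic. Plan: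
`AddSubgroup.closure_induction` over the PROVED generator case `HodgeLevel.DimOneRationalValues.dimOneRationalValues_proof`
(dimension 1) and the constant case (dimension 0: value `= integrand default ∈ ℚ` or `0`); sums by `Fin.append`,
negatives by `βⱼ ↦ −βⱼ`. (Alternatively from `PiBox.Dlog.nfD_of_mem_closure_dim_le_one`: `c·log u`, `d·arctan t =
(d/2i)·log((1+it)/(1−it))`.) [cite: KontsevichZagier2001, §1.1] -/
theorem stub_ratSectorValues : RatSectorValues := by
  sorry

/-! ## The composition (real proof) -/

/-- **From the log-enriched class reduction to log-enriched real-period independence**: the floor's HW-free class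
analysis (`R-b2`–`R-b4`, `R-a`, all landed) run verbatim on the per-class vanishing delivered by stub 1. -/
theorem realPeriodsModLogs (h1 : LogClassReduction) :
    ∀ (k : ℕ) (A B : Fin k → ℤ) (q : Fin k → ℚ), (∀ i, 4 * A i ^ 3 + 27 * B i ^ 2 ≠ 0) →
    (∀ i j, i ≠ j → ¬ ∃ (f g : Polynomial ℚ) (c : ℚ), Polynomial.derivative f * g - f * Polynomial.derivative g ≠ 0 ∧
        Polynomial.C (c ^ 2) * g * (f ^ 3 + Polynomial.C (A j : ℚ) * f * g ^ 2 + Polynomial.C (B j : ℚ) * g ^ 3) =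
          (Polynomial.X ^ 3 + Polynomial.C (A i : ℚ) * Polynomial.X + Polynomial.C (B i : ℚ)) *
            (Polynomial.derivative f * g - f * Polynomial.derivative g) ^ 2) →
    ∀ (m : ℕ) (β₀ : ℂ) (β y : Fin m → ℂ), IsAlgebraic ℚ β₀ → (∀ j, IsAlgebraic ℚ (β j)) →
      (∀ j, IsAlgebraic ℚ (Complex.exp (y j))) →
      ((∑ i, (q i : ℝ) * (∫ x in {x : Fin 1 → ℝ | 0 < x 0 ^ 3 + (A i : ℝ) * x 0 + (B i : ℝ)},
          1 / Real.sqrt (x 0 ^ 3 + (A i : ℝ) * x 0 + (B i : ℝ))) : ℝ) : ℂ) = β₀ + ∑ j, β j * y j →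
      ∀ i, q i = 0 := by
  classical
  -- independence modulo RATIONAL lattice multipliers (the floor's `hmod`, with stub 1 replacing `stub_classReduction`)
  have hmod : ∀ (k : ℕ) (A B : Fin k → ℤ) (q : Fin k → ℚ), (∀ i, 4 * A i ^ 3 + 27 * B i ^ 2 ≠ 0) →
      (∀ i j, i ≠ j → ¬ ∃ (L L' : PeriodPair) (c : ℚ), L.g₂ = -4 * (A i : ℂ) ∧ L.g₃ = -4 * (B i : ℂ) ∧
        L'.g₂ = -4 * (A j : ℂ) ∧ L'.g₃ = -4 * (B j : ℂ) ∧ c ≠ 0 ∧ ∀ l ∈ L.lattice, (c : ℂ) * l ∈ L'.lattice) →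
      ∀ (m : ℕ) (β₀ : ℂ) (β y : Fin m → ℂ), IsAlgebraic ℚ β₀ → (∀ j, IsAlgebraic ℚ (β j)) →
      (∀ j, IsAlgebraic ℚ (Complex.exp (y j))) →
      ((∑ i, (q i : ℝ) * (∫ x in {x : Fin 1 → ℝ | 0 < x 0 ^ 3 + (A i : ℝ) * x 0 + (B i : ℝ)},
          1 / Real.sqrt (x 0 ^ 3 + (A i : ℝ) * x 0 + (B i : ℝ))) : ℝ) : ℂ) = β₀ + ∑ j, β j * y j → ∀ i, q i = 0 := by
    intro k A B q hns hnrm m β₀ β y hβ₀ hβ hy hsum i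
    obtain ⟨L₀, h2, h3, hclass⟩ := h1 k A B q hns m β₀ β y hβ₀ hβ hy hsum i
    set S : Finset (Fin k) := Finset.univ.filter (fun j => ∃ (L' : PeriodPair) (α : ℂ),
      L'.g₂ = -4 * (A j : ℂ) ∧ L'.g₃ = -4 * (B j : ℂ) ∧ α ≠ 0 ∧ ∀ l ∈ L₀.lattice, α * l ∈ L'.lattice) with hSdef
    have hS : ∀ j, j ∈ S ↔ ∃ (L' : PeriodPair) (α : ℂ),
        L'.g₂ = -4 * (A j : ℂ) ∧ L'.g₃ = -4 * (B j : ℂ) ∧ α ≠ 0 ∧ ∀ l ∈ L₀.lattice, α * l ∈ L'.lattice := by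
      intro j
      simp [hSdef]
    have hsumS := hclass S hS
    have hmem : ∀ j ∈ S, ∃ (L' : PeriodPair) (α : ℂ),
        L'.g₂ = -4 * (A j : ℂ) ∧ L'.g₃ = -4 * (B j : ℂ) ∧ α ≠ 0 ∧ ∀ l ∈ L₀.lattice, α * l ∈ L'.lattice :=
      fun j hj => (hS j).1 hj
    have hnrmS : ∀ i ∈ S, ∀ j ∈ S, i ≠ j → ¬ ∃ (L L' : PeriodPair) (c : ℚ), L.g₂ = -4 * (A i : ℂ) ∧
        L.g₃ = -4 * (B i : ℂ) ∧ L'.g₂ = -4 * (A j : ℂ) ∧ L'.g₃ = -4 * (B j : ℂ) ∧ c ≠ 0 ∧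
        ∀ l ∈ L.lattice, (c : ℂ) * l ∈ L'.lattice :=
      fun i _ j _ hij => hnrm i j hij
    have hg₂ : ∃ q₀ : ℚ, (q₀ : ℂ) = L₀.g₂ := ⟨-4 * A i, by rw [h2]; push_cast; ring⟩
    have hg₃ : ∃ q₀ : ℚ, (q₀ : ℂ) = L₀.g₃ := ⟨-4 * B i, by rw [h3]; push_cast; ring⟩
    have hi : i ∈ S := (hS i).2 ⟨L₀, 1, h2, h3, one_ne_zero, fun l hl => by simpa using hl⟩
    by_cases hCM : L₀.HasCM
    · exact CMClass.stub_cmClass MultiplierRigidity.stub_multiplierRigidity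
        RadicalIndependence.stub_radicalIndependence k A B q S L₀ hns hg₂ hg₃ hCM hmem hnrmS hsumS i hi
    · exact NonCMClass.stub_nonCMClass MultiplierRigidity.stub_multiplierRigidity
        RadicalIndependence.stub_radicalIndependence k A B q S L₀ hns hg₂ hg₃ hCM hmem hnrmS hsumS i hi
  -- datum form, by the contrapositive of R-a (landed `stub_datumOfRatMult`)
  intro k A B q hns hnd m β₀ β y hβ₀ hβ hy hsum
  refine hmod k A B q hns ?_ m β₀ β y hβ₀ hβ hy hsum
  intro i j hij hrat
  obtain ⟨L, L', c, e1, e2, e3, e4, hc, hmul⟩ := hrat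
  exact hnd i j hij
    (DatumOfRatMult.stub_datumOfRatMult (A i) (B i) (A j) (B j) (hns i) (hns j) L L' c e1 e2 e3 e4 hc hmul)

/-- **The composition: the three stubs imply the rung `LogPeriodCell`.** Real proof: split along
`closure (s ∪ t) = closure s ⊔ closure t`; value normal forms (stubs 2, 3); the seam (stub 1 via
`realPeriodsModLogs`) kills every `qᵢ`; so both halves have value `0` and lie in `KZ.relations` by the two PROVED
kernel cells (`XMapKernelCells.realPeriodCellKernel_relations`, `PiBox.Dlog.mem_relations_of_eval_eq_zero_of_dim_le_one`). -/
theorem LogPeriodCell_of : LogClassReduction → PeriodSectorValues → RatSectorValues → LogPeriodCell := by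
  intro h1 h2 h3 c hc hc0
  classical
  rw [AddSubgroup.closure_union] at hc
  obtain ⟨cP, hcP, cR, hcR, rfl⟩ := AddSubgroup.mem_sup.mp hc
  obtain ⟨k, A, B, q, hns, hnd, hvalP⟩ := h2 cP hcP
  obtain ⟨m, β₀, β, y, hβ₀, hβ, hy, hvalR⟩ := h3 cR hcR
  rw [map_add] at hc0
  -- the mixed relation, moved to the shape of the seam
  have hPR : KZ.eval cP = -KZ.eval cR := by linarith
  have hsum : ((∑ i, (q i : ℝ) * (∫ x in {x : Fin 1 → ℝ | 0 < x 0 ^ 3 + (A i : ℝ) * x 0 + (B i : ℝ)},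
      1 / Real.sqrt (x 0 ^ 3 + (A i : ℝ) * x 0 + (B i : ℝ))) : ℝ) : ℂ) = (-β₀) + ∑ j, (-β j) * y j := by
    rw [← hvalP, hPR, Complex.ofReal_neg, hvalR, neg_add, ← Finset.sum_neg_distrib]
    simp [neg_mul]
  have hq : ∀ i, q i = 0 :=
    realPeriodsModLogs h1 k A B q hns hnd m (-β₀) (fun j => -β j) y hβ₀.neg (fun j => (hβ j).neg) hy hsum
  have hP0 : KZ.eval cP = 0 := by
    rw [hvalP]
    simp [hq]
  have hR0 : KZ.eval cR = 0 := by linarith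
  exact add_mem (XMapKernelCells.realPeriodCellKernel_relations cP hcP hP0)
    (Summit.KontsevichZagierPeriods.HurwitzMicroSectors.NormalFormPrinciple.PiBox.Dlog.mem_relations_of_eval_eq_zero_of_dim_le_one
      hcR hR0)

/-! ## Ladder to the top: the LIMIT STEP (registered so that the ladder composes to the crux BY NAME,
G4 brief (3); flagged honestly: it is the census's `K`, summit-strength once the rung lands — NOT a work
target of this line, whose content is `LogPeriodCell_of` above)

`gap_after` in words (LADDER-XMapKernel.md): `ratGensLE 1` → `+ EggGens` (third-kind elliptic generators,
JointEllipticCell) → `OnePeriodGens` (all 1-periods, Huber–Wüstholz maximal) ‖ceiling of the method‖ →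
`ratGensLE 2` (weight 2) → … → `Set.univ` (`MixedCell Set.univ ↔ KontsevichZagierPeriods`, proved in Sketch.lean). -/

/-- Statement of the limit step: the passage from the rung's sector to every sector. -/
def LimitStep : Prop := LogPeriodCell → MixedCell Set.univ

/-- **Stub 4 (LIMIT STEP — summit-strength given the rung; do not staff before the rung lands).**
`LogPeriodCell → MixedCell Set.univ`: all further rungs of the ladder at once. On its own it does NOT give
`S` or the crux cheaply (it needs the rung: probes in `bc/`), but once `LogPeriodCell` is a theorem it is
`↔ KontsevichZagierPeriods` — exactly the remainder `K` on which the three earlier lines died. Registered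
only so that `XMapKernel_of` concludes the crux by name; the bankable target of this line is the RUNG. -/
theorem stub_limitStep : LimitStep := by
  sorry

/-- **Ladder composition to the crux by name** (closed form, the registered-skeleton convention: the proof
USES the four `stub_*`; `sorry` lives only inside them): the three rung stubs give `LogPeriodCell`
(`LogPeriodCell_of`, real proof), the limit step gives `MixedCell Set.univ`, and at `T = Set.univ` the family is
the kernel conjecture, i.e. the crux (landed `XMapKernelIffSummit.xMapKernel_iff_kzKernelConjecture`). -/
theorem XMapKernel_of : XMapKernel := by
  refine XMapKernelIffSummit.xMapKernel_iff_kzKernelConjecture.mpr ?_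
  intro c hc0
  refine stub_limitStep (LogPeriodCell_of stub_logClassReduction stub_periodSectorValues stub_ratSectorValues) c ?_ hc0
  simp only [Set.union_univ, AddSubgroup.closure_univ]
  exact AddSubgroup.mem_top c

/-- The rung itself, from its three stubs (closed form). -/
theorem logPeriodCell_of_stubs : LogPeriodCell :=
  LogPeriodCell_of stub_logClassReduction stub_periodSectorValues stub_ratSectorValues

/-- Sanity: the `m = 0, β₀ = 0` instance of the seam's conclusion chain is the floor's engine (landed). -/
example : ∀ (k : ℕ) (A B : Fin k → ℤ) (q : Fin k → ℚ), (∀ i, 4 * A i ^ 3 + 27 * B i ^ 2 ≠ 0) →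
    (∀ i j, i ≠ j → ¬ ∃ (f g : Polynomial ℚ) (c : ℚ), Polynomial.derivative f * g - f * Polynomial.derivative g ≠ 0 ∧
        Polynomial.C (c ^ 2) * g * (f ^ 3 + Polynomial.C (A j : ℚ) * f * g ^ 2 + Polynomial.C (B j : ℚ) * g ^ 3) =
          (Polynomial.X ^ 3 + Polynomial.C (A i : ℚ) * Polynomial.X + Polynomial.C (B i : ℚ)) *
            (Polynomial.derivative f * g - f * Polynomial.derivative g) ^ 2) →
    ∑ i, (q i : ℝ) * (∫ x in {x : Fin 1 → ℝ | 0 < x 0 ^ 3 + (A i : ℝ) * x 0 + (B i : ℝ)},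
      1 / Real.sqrt (x 0 ^ 3 + (A i : ℝ) * x 0 + (B i : ℝ))) = 0 → ∀ i, q i = 0 :=
  XMapKernelCells.realPeriodIndependence_holds

end Summit.KontsevichZagierPeriods.KontsevichZagierPeriods.Cruxes.XMapKernel.LogPeriodCell
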